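import Summits.BirchSwinnertonDyer.BirchSwinnertonDyer.Theorems.PrintCf2RamifiedOffTYZGeneratorDepth
import Literature.NumberTheory.EllipticCurves.TianYuanZhang2017.CMPointCompositumDisplays
import HarnessLib

/-!
# Route `PrintCf2`, crux stmt-BirchSwinnertonDyer-20509 `RamifiedOffTYZOfFacts` — GENERATOR DEPTH WITH BLOCKS: the central automorphism of the
# depth theorem in the PAPER'S currency (`Gal(ℍ′_n/H′_{d₀})`, complex conjugation, the compositum sentence) — an INVOLUTION ON EVERY BLOCK IS CENTRAL
# (cell `bsd-print-cf2`, LEAD of 20509 g18, line `offtyz-v7`, lineage cycle 19; fact-free, Theses-free, no `def`)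

HONEST FRAMING (crux 20509 = `𝔅_ram → WAllCornerFTwoRamifiedOffTYZProved`, DECIDING, OPEN AS A CLASS; C⁺ = `stub_offTYZ_levelTwoScriptLExact`
= item 23431).  `…GeneratorDepth.not_fourDivisible_map_ΘA_of_central` proves «`α_n ∉ 4A(ℍ′_n) + tors`» from an automorphism `g₀` of `ℍ′_n`
with `g₀(i) = i`, `g₀(√−n) = −√−n` that COMMUTES with every automorphism fixing `i` and `√−n` — automatic on the block-free family
(`Gal(ℍ′_n/ℚ)` abelian), an ad-hoc hypothesis otherwise.  THIS file replaces the ad-hoc hypothesis by one stated ON THE DISPLAYED OBJECTS of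
[TianYuanZhang2017] §3.1–3.2 (`CMBlockSpec`: the subgroups `Gal(ℍ′_n/H′_{d₀})` of the blocks `d₀ ≡ 5, 6 (mod 8)`, normal, containing the
commutators of `K_{d₀}`-automorphisms (G3) and inverted by complex conjugation (G5); `ConjSpec`; the compositum sentence `CompositumSpec`
"`ℍ′_n = L_n(i)·∏ H′_{d₀}`"):

* §1 `commute_of_sq_mem_blocks` — **an automorphism `g₀` of `ℍ′_n` that fixes `√−d₀` and whose square lies in `Gal(ℍ′_n/H′_{d₀})` for EVERY
  block `d₀` is CENTRAL in `Gal(ℍ′_n/ℚ)`** (its commutator with any `σ` is trivial on `L_n(i)` — everybody acts there by signs — and lies in every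
  `Gal(ℍ′_n/H′_{d₀})`: by (G3) when `σ` fixes `√−d₀`, by (G5)+(G3) when `σ = c·t₀` flips it; then (C) says the commutator is `1`).  Group
  theory of generalized dihedral groups read on the displays; no arithmetic.
* §2 `not_fourDivisible_map_ΘA_of_involution` — the depth theorem with the central `g₀` supplied by §1: hypotheses = Lemma 3.18 (displayed),
  the CM-point/compositum layer (displayed shapes, exactly the conjuncts of `CMPointCompositumPrinted`), and an automorphism `g₀` with
  `g₀(i) = i`, `g₀(√−n) = −√−n`, `g₀(√−d₀) = √−d₀` and `g₀² ∈ Gal(ℍ′_n/H′_{d₀})` for every block — i.e. an element of `Gal(ℍ′_n/ℚ(i))` flipping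
  `√−n` that restricts to an element of order `≤ 2` of every `Gal(H′_{d₀}/K_{d₀}) ≅ Pic(𝒪₂(K_{d₀}))`.

WHAT THIS DOES AND DOES NOT BUY (LEAD census, NOTES 09:40Z): with ONE block `d₀` the displayed Frobenius element `φ_q` (`q ∣ d₀`,
`FrobeniusTwoBlockSpec`: fixes `√−d₀`, `φ_q² ∈ Gal(ℍ′_n/H′_{d₀})`, signs by Legendre symbols) is such a `g₀` under a Legendre condition — but a
square-free `n ≡ 7 (mod 8)` has exactly one block only when `n = pq`, `(p, q) ≡ (3, 5) (mod 8)`, where Monsky's `s(n) = 1` (his `4 × 4` matrix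
over `𝔽₂` has rank `3` for either value of `(p/q)`) — not the jump-one class of C⁺.  Jump-one `n ≡ 7 (mod 8)` with blocks have `≥ 2` blocks, and the existence of `g₀` is then a condition on the classes of the ramified primes
of one block in the ring class groups of the others — NOT a display; this file isolates exactly that condition as the ONLY input the generator
side of C⁺ still wants off the block-free family.  BSD is not proved by any of this; C⁺ and the crux stay OPEN AS A CLASS.

References: [TianYuanZhang2017] Y. Tian, X. Yuan, S.-W. Zhang, *Genus periods, genus points and congruent number problem*, Asian J. Math. 21
(2017) — §3.1 (p0011 L1–L13, L58–L66), Prop. 3.2 (1)(2) (p0010 L106–L113), Thm. 3.6 (p0012 L22–L36), Lemma 3.18; D. A. Cox, *Primes of the form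
x² + ny²*, 2nd ed. (2013), Lemma 9.3, §9.A [Cox2013]; S. Lang, *Algebra*, GTM 211, VI §1 Thm. 1.2, Cor. 1.4 [Lang2002]; tree:
`…GeneratorDepth` (g18), `TianYuanZhang2017/CMPointGaloisDisplays`, `…/CMPointCompositumDisplays` (g16).
-/

noncomputable section

open scoped Classical

open WeierstrassCurve WeierstrassCurve.Affine WeierstrassCurve.Affine.Point
  Literature.NumberTheory.EllipticCurves Literature.NumberTheory.EllipticCurves.Rank1Residual
  Summit.BirchSwinnertonDyer.Rank1Residual
  Literature.NumberTheory.EllipticCurves.TianYuanZhang2017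
  Literature.NumberTheory.EllipticCurves.TianYuanZhang2017.W2
  Summit.BirchSwinnertonDyer.PrintCf2.GaloisMotion
  Summit.BirchSwinnertonDyer.Rank1Residual.P2.ThetaDescent
  Summit.BirchSwinnertonDyer.PrintCf2.LowerHalfVisible

set_option autoImplicit false

namespace Summit.BirchSwinnertonDyer.PrintCf2.GeneratorDepth

variable {n : ℕ}

/-! ## §1 An involution on every block is central -/

/-- `g x = x ⟹ g⁻¹ x = x`. [folklore] -/
private theorem inv_apply_of_apply_eq' (D : GenusPointData n) {g : D.H ≃ₐ[ℚ] D.H} {x : D.H} (h : g x = x) : g⁻¹ x = x := by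
  have e : g⁻¹ (g x) = x := by rw [← AlgEquiv.mul_apply, inv_mul_cancel, AlgEquiv.one_apply]
  rwa [h] at e

/-- **AN INVOLUTION ON EVERY BLOCK IS CENTRAL.**  Data `D : GenusPointData n`; subgroups `ΓH' d₀ = Gal(ℍ′_n/H′_{d₀})` of the blocks
`d₀ ∣ n`, `d₀ ≡ 5, 6 (mod 8)`, NORMAL and containing the COMMUTATORS of automorphisms fixing `√−d₀` ((G3): `H′_{d₀}/ℚ` Galois, `H′_{d₀} ⊂ K_{d₀}^{ab}`);
a complex conjugation `c` (`c(√−d) = −√−d` for `d ∣ n`, `c² = 1`) INVERTING every `Gal(H′_{d₀}/K_{d₀})` ((G5): `c t c t ∈ Gal(ℍ′_n/H′_{d₀})`);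
and the compositum sentence (C) "`ℍ′_n = L_n(i)·∏ H′_{d₀}`".  Then an automorphism `g₀` with `g₀(√−d₀) = √−d₀` and `g₀² ∈ Gal(ℍ′_n/H′_{d₀})` for
every block commutes with EVERY automorphism `σ` of `ℍ′_n`: the commutator `g₀σg₀⁻¹σ⁻¹` is trivial on `L_n(i)` (all automorphisms act on `i` and
the `√−d` by signs) and lies in each `Gal(ℍ′_n/H′_{d₀})` — by (G3) if `σ` fixes `√−d₀`; if not, `σ = c·t₀` with `t₀` fixing `√−d₀`, and
`g₀σg₀⁻¹σ⁻¹ = g₀·(c u c u)·(t₀g₀t₀⁻¹g₀⁻¹)·g₀⁻¹·g₀²` with `u = t₀g₀⁻¹t₀⁻¹` — so (C) makes it `1`.  (A `2`-torsion rotation is central in a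
generalized dihedral group.)
[cite: TianYuanZhang2017, §3.1 (p0011 L1–L13, L58–L66), Prop. 3.2 (1)(2) (p0010 L106–L113), Thm. 3.6 (p0012 L22–L36)]
[cite: Cox2013, Lemma 9.3 and §9.A] [cite: Lang2002, VI §1 Thm. 1.2, Cor. 1.4] -/
theorem commute_of_sq_mem_blocks (D : GenusPointData n) {ΓH' : ℕ → Subgroup (D.H ≃ₐ[ℚ] D.H)} (hC : D.CompositumSpec ΓH')
    {c : D.H ≃ₐ[ℚ] D.H} (hcK : ∀ d ∈ n.divisors, c (D.sqrtNeg d) = -D.sqrtNeg d) (hcc : c * c = 1)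
    (hnorm : ∀ d ∈ n.divisors, (d % 8 = 5 ∨ d % 8 = 6) → ∀ g γ : D.H ≃ₐ[ℚ] D.H, γ ∈ ΓH' d → g * γ * g⁻¹ ∈ ΓH' d)
    (hcomm : ∀ d ∈ n.divisors, (d % 8 = 5 ∨ d % 8 = 6) → ∀ s t : D.H ≃ₐ[ℚ] D.H,
      s (D.sqrtNeg d) = D.sqrtNeg d → t (D.sqrtNeg d) = D.sqrtNeg d → s⁻¹ * t⁻¹ * s * t ∈ ΓH' d)
    (hinv : ∀ d ∈ n.divisors, (d % 8 = 5 ∨ d % 8 = 6) → ∀ t : D.H ≃ₐ[ℚ] D.H,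
      t (D.sqrtNeg d) = D.sqrtNeg d → c * t * c * t ∈ ΓH' d)
    {g₀ : D.H ≃ₐ[ℚ] D.H} (hg₀B : ∀ d ∈ n.divisors, (d % 8 = 5 ∨ d % 8 = 6) → g₀ (D.sqrtNeg d) = D.sqrtNeg d)
    (hg₀2 : ∀ d ∈ n.divisors, (d % 8 = 5 ∨ d % 8 = 6) → g₀ * g₀ ∈ ΓH' d) (σ : D.H ≃ₐ[ℚ] D.H) :
    g₀ * σ = σ * g₀ := by
  have hcinv : c⁻¹ = c := inv_eq_of_mul_eq_one_right hcc
  have h1 : g₀ * σ * g₀⁻¹ * σ⁻¹ = 1 := by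
    refine hC _ (D.trivialOnL_commutator g₀ σ) fun d hd h56 => ?_
    have hg₀d := hg₀B d hd h56
    rcases D.algEquiv_sqrtNeg_eq_or hd σ with hσ | hσ
    · -- `σ` fixes `√−d`: the commutator of two `K_d`-automorphisms
      have h := hcomm d hd h56 g₀⁻¹ σ⁻¹ (inv_apply_of_apply_eq' D hg₀d) (inv_apply_of_apply_eq' D hσ)
      simpa only [inv_inv] using h
    · -- `σ = c·t₀` flips `√−d`
      set t₀ : D.H ≃ₐ[ℚ] D.H := c * σ with ht₀_def
      have ht₀ : t₀ (D.sqrtNeg d) = D.sqrtNeg d := by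
        rw [ht₀_def, AlgEquiv.mul_apply, hσ, map_neg, hcK d hd, neg_neg]
      have hσe : σ = c * t₀ := by rw [ht₀_def, ← mul_assoc, hcc, one_mul]
      set u : D.H ≃ₐ[ℚ] D.H := t₀ * g₀⁻¹ * t₀⁻¹ with hu_def
      have hu : u (D.sqrtNeg d) = D.sqrtNeg d := by
        rw [hu_def, AlgEquiv.mul_apply, AlgEquiv.mul_apply, inv_apply_of_apply_eq' D ht₀, inv_apply_of_apply_eq' D hg₀d, ht₀]
      have hγ₁ : c * u * c * u ∈ ΓH' d := hinv d hd h56 u hu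
      have hγ₂ : t₀ * g₀ * t₀⁻¹ * g₀⁻¹ ∈ ΓH' d := by
        have h := hcomm d hd h56 t₀⁻¹ g₀⁻¹ (inv_apply_of_apply_eq' D ht₀) (inv_apply_of_apply_eq' D hg₀d)
        simpa only [inv_inv] using h
      have hmem : g₀ * ((c * u * c * u) * (t₀ * g₀ * t₀⁻¹ * g₀⁻¹)) * g₀⁻¹ * (g₀ * g₀) ∈ ΓH' d :=
        (ΓH' d).mul_mem (hnorm d hd h56 g₀ _ ((ΓH' d).mul_mem hγ₁ hγ₂)) (hg₀2 d hd h56)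
      have e : g₀ * σ * g₀⁻¹ * σ⁻¹ = g₀ * ((c * u * c * u) * (t₀ * g₀ * t₀⁻¹ * g₀⁻¹)) * g₀⁻¹ * (g₀ * g₀) := by
        rw [hσe, mul_inv_rev, hcinv, hu_def]
        group
      rw [e]
      exact hmem
  calc g₀ * σ = (g₀ * σ * g₀⁻¹ * σ⁻¹) * (σ * g₀) := by group
    _ = σ * g₀ := by rw [h1, one_mul]

/-- **The same, with the block data packaged as in `CMPointCompositumPrinted`** (`ConjSpec c`, `CMBlockSpec` for every block, `CompositumSpec`):
an automorphism fixing every block's `√−d₀` with square in every `Gal(ℍ′_n/H′_{d₀})` is central.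
[cite: TianYuanZhang2017, §3.1 (p0011 L1–L13, L58–L66), Prop. 3.2 (1)(2) (p0010 L106–L113), Thm. 3.6 (p0012 L22–L36)] [cite: Cox2013, Lemma 9.3 and §9.A] -/
theorem commute_of_sq_mem_blocks' (D : GenusPointData n) {z : ℕ → APoint D.H} {Φ : ℕ → Finset (D.H ≃ₐ[ℚ] D.H)}
    {ΓH ΓH' : ℕ → Subgroup (D.H ≃ₐ[ℚ] D.H)} {σb : ℕ → (D.H ≃ₐ[ℚ] D.H)} {c : D.H ≃ₐ[ℚ] D.H} (hc : D.ConjSpec c)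
    (hblk : ∀ d ∈ n.divisors, (d % 8 = 5 ∨ d % 8 = 6) → D.CMBlockSpec d (z d) (Φ d) (ΓH d) (ΓH' d) (σb d) c)
    (hC : D.CompositumSpec ΓH')
    {g₀ : D.H ≃ₐ[ℚ] D.H} (hg₀B : ∀ d ∈ n.divisors, (d % 8 = 5 ∨ d % 8 = 6) → g₀ (D.sqrtNeg d) = D.sqrtNeg d)
    (hg₀2 : ∀ d ∈ n.divisors, (d % 8 = 5 ∨ d % 8 = 6) → g₀ * g₀ ∈ ΓH' d) (σ : D.H ≃ₐ[ℚ] D.H) :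
    g₀ * σ = σ * g₀ :=
  commute_of_sq_mem_blocks D hC hc.2.1 hc.2.2
    (fun d hd h56 => (hblk d hd h56).2.2.1.2.1) (fun d hd h56 => (hblk d hd h56).2.2.1.2.2)
    (fun d hd h56 => (hblk d hd h56).2.2.2.2.1.1) hg₀B hg₀2 σ

/-! ## §2 The depth theorem with blocks: an `i`-fixing, `√−n`-flipping involution on every block suffices -/

/-- **THE GENERATOR HAS DEPTH AT MOST ONE — INVOLUTION FORM (with blocks).**  Square-free odd `n`; data `D : GenusPointData n` with Lemma 3.18
(`A(ℍ′_n)_tor ⊆ A[(1+i)³]`) and the CM-point / compositum layer of §3.1–3.2 (`ConjSpec c`, `CMBlockSpec` for every block `d₀ ≡ 5, 6 (mod 8)`,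
"`ℍ′_n = L_n(i)·∏ H′_{d₀}`"); an automorphism `g₀` with `g₀(i) = i`, `g₀(√−n) = −√−n`, `g₀(√−d₀) = √−d₀` and `g₀² ∈ Gal(ℍ′_n/H′_{d₀})` for every
block (an element of `Gal(ℍ′_n/ℚ(i))` flipping `√−n` that is an involution of every `H′_{d₀}/K_{d₀}`); `α₀` a generator of `A_n(ℚ)` modulo
torsion, of infinite order.  Then **`ι Θ_A(α₀) ∉ 4·A(ℍ′_n) + A(ℍ′_n)_tor`**.  (`g₀` is central by §1; then `…of_central`.)  On the block-free
family any `i`-fixing `√−n`-flipping `g₀` qualifies (no blocks); with one block the Frobenius element of a ramified prime does under a Legendre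
condition; with several blocks the existence of `g₀` is a ring-class-group condition the displays do not decide.
[cite: TianYuanZhang2017, §3.1 (p0011 L27–L36, L58–L66), Prop. 3.2 (1)(2)(3) (p0010 L106–L113), Thm. 3.6 (p0012 L22–L36), Lemma 3.16 (p0017 L98–L113), Lemma 3.18 (p0017 L152–L153)]
[cite: Cox2013, Lemma 9.3 and §9.A] [cite: SilvermanAEC2009, X.5 Cor. 5.4] [cite: Lang2002, VI §1 Thm. 1.2, Cor. 1.4] -/
theorem not_fourDivisible_map_ΘA_of_involution (hsq : Squarefree n) (hodd : Odd n) (D : GenusPointData n) (h318 : D.lemma318)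
    {z : ℕ → APoint D.H} {Φ : ℕ → Finset (D.H ≃ₐ[ℚ] D.H)} {ΓH ΓH' : ℕ → Subgroup (D.H ≃ₐ[ℚ] D.H)} {σb : ℕ → (D.H ≃ₐ[ℚ] D.H)}
    {c : D.H ≃ₐ[ℚ] D.H} (hc : D.ConjSpec c)
    (hblk : ∀ d ∈ n.divisors, (d % 8 = 5 ∨ d % 8 = 6) → D.CMBlockSpec d (z d) (Φ d) (ΓH d) (ΓH' d) (σb d) c)
    (hC : D.CompositumSpec ΓH')
    {g₀ : D.H ≃ₐ[ℚ] D.H} (hg₀i : g₀ D.im = D.im) (hg₀K : g₀ (D.sqrtNeg n) = -D.sqrtNeg n)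
    (hg₀B : ∀ d ∈ n.divisors, (d % 8 = 5 ∨ d % 8 = 6) → g₀ (D.sqrtNeg d) = D.sqrtNeg d)
    (hg₀2 : ∀ d ∈ n.divisors, (d % 8 = 5 ∨ d % 8 = 6) → g₀ * g₀ ∈ ΓH' d)
    {α₀ : (Atwo n).toAffine.Point} (hgen : ∀ P : (Atwo n).toAffine.Point, ∃ m : ℤ, IsOfFinAddOrder (P - m • α₀))
    (hα : ¬ IsOfFinAddOrder α₀) :
    ¬ ∃ y : APoint D.H, IsOfFinAddOrder
      (Point.map (W' := curveA) (D.embK n (Nat.mem_divisors_self n hsq.ne_zero)) (ΘA hsq.ne_zero α₀) - (4 : ℤ) • y) :=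
  not_fourDivisible_map_ΘA_of_central hsq hodd D h318 hg₀i hg₀K
    (fun σ _ _ => commute_of_sq_mem_blocks' D hc hblk hC hg₀B hg₀2 σ) hgen hα

end Summit.BirchSwinnertonDyer.PrintCf2.GeneratorDepth

end
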